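import Summits.ValiantsHypothesis.ValiantsHypothesis.Theorems.LacunarySymmetroidMatrixDescartesCensusDoorA34NodeChambersComplex
import Summits.ValiantsHypothesis.ValiantsHypothesis.Theorems.LacunarySymmetroidMatrixDescartesCensusDoorA34NodeChambers

/-!
# `MatrixDescartes` census — DOOR A at `(3,4)`: DOUBLE WALLS — two node nomials vanishing together give a det-root whose type is
# the sign of the product of the other two (class R4), resp. always indefinite (class R2)

HONEST FRAMING.  Object-search cell `pub-symmetroid`, door-A seat `val-sym-door-p3` (g9); item stmt-ValiantsHypothesis-19980
`DoorA34 = PosRootLawAt 3 4 18` (route item `Theses.LacunarySymmetroid.DoorA34`) is OPEN and asserted nowhere in this file.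
Edge case of the chamber law (`…NodeChambers`: simple walls carry no root; open chambers: type = parity).  On the census the
walls of the R4 seventeens come in near-coincident PAIRS (passage near an edge point of the hugged non-edge line); at an exact
coincidence — a DOUBLE WALL `ℓ₀ = ℓ₁ = 0` — the matrix is `ℓ₂ v₂v₂ᵀ + ℓ₃ v₃v₃ᵀ`:

* `det_eq_zero_of_doubleWall` — `det = 0` (a det-root sits ON every double wall);
* `posSemidef_of_doubleWall_nonneg` / `neg_posSemidef_of_doubleWall_nonpos` — `ℓ₂, ℓ₃ ≥ 0` (resp. `≤ 0`) ⇒ semidefinite type;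
* `indefinite_of_doubleWall_opposite` — `ℓ₂ > 0 > ℓ₃` and `v₀, v₂, v₃` independent ⇒ `xᵀMx` takes both strict signs (test
  vectors `v₂ × v₀` and `v₃ × v₀`): indefinite type, a middle-eigenvalue root.

Class R2 (two real nodes `v₀, v₁`, a conjugate pair `r ± is`, normal form of `…NodeChambersComplex`): on the double wall
`ℓ₀ = ℓ₁ = 0` the matrix is the pair form `N = m_R(rrᵀ − ssᵀ) − m_I(rsᵀ + srᵀ)`:

* `det_R2_doubleWall` — `det N = 0`;
* `exists_pair_testVectors`, `indefinite_R2_doubleWall_of_testVectors`, **`indefinite_R2_doubleWall`**,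
  `not_posSemidef_R2_doubleWall` — for `(m_R, m_I) ≠ 0` and `r, s` independent (`‖r × s‖² ≠ 0`) the form `xᵀNx` takes both strict
  signs (test vectors `x₁ = s × (r × s)`, `x₂ = r × (r × s)`, values `±m_R G²` and, at `x₁ ± x₂`, `±2 m_I G²`, `G = ‖r × s‖²`):
  an R2 double-wall root is ALWAYS of indefinite type.

Node labels are arbitrary (permute).  Nothing here bounds `ζ_sym(3,4)`; `DoorA34` stays OPEN; nothing bears on `MatrixDescartes`
(stmt-ValiantsHypothesis-18050) or on `VP ≠ VNP`.  [folklore] Elementary.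
-/

-- `Summit.ValiantsHypothesis.ValiantsHypothesis.…` repeats a component by the D-0017 layout
-- (single-conjunct summit), which the `dupNamespace` linter flags; the name is mandated.
set_option linter.dupNamespace false

namespace Summit.ValiantsHypothesis.ValiantsHypothesis.Theorems.LacunarySymmetroidMatrixDescartes.Census

open Finset
open scoped BigOperators Matrix

/-- **A double wall is a det-root**: `ℓ₀ = ℓ₁ = 0 ⇒ det (∑ᵢ ℓᵢ • vᵢvᵢᵀ) = 0`. [folklore] -/
theorem det_eq_zero_of_doubleWall (v : Fin 4 → Fin 3 → ℝ) (ℓ : Fin 4 → ℝ) (h0 : ℓ 0 = 0) (h1 : ℓ 1 = 0) :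
    (∑ i, ℓ i • Matrix.vecMulVec (v i) (v i)).det = 0 := by
  rw [det_sum_four_rankOne, h0, h1]; ring

/-- **Double wall, same signs ⇒ semidefinite.**  `ℓ₀ = ℓ₁ = 0`, `ℓ₂, ℓ₃ ≥ 0` ⇒ `∑ᵢ ℓᵢ • vᵢvᵢᵀ ⪰ 0`. [folklore] -/
theorem posSemidef_of_doubleWall_nonneg (v : Fin 4 → Fin 3 → ℝ) (ℓ : Fin 4 → ℝ) (h0 : ℓ 0 = 0) (h1 : ℓ 1 = 0)
    (h2 : 0 ≤ ℓ 2) (h3 : 0 ≤ ℓ 3) : (∑ i, ℓ i • Matrix.vecMulVec (v i) (v i)).PosSemidef := by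
  refine posSemidef_sum_smul_vecMulVec_of_nonneg v ℓ fun i => ?_
  fin_cases i
  · exact h0.symm.le
  · exact h1.symm.le
  · exact h2
  · exact h3

/-- … and `ℓ₂, ℓ₃ ≤ 0` ⇒ `−(∑ᵢ ℓᵢ • vᵢvᵢᵀ) ⪰ 0`. [folklore] -/
theorem neg_posSemidef_of_doubleWall_nonpos (v : Fin 4 → Fin 3 → ℝ) (ℓ : Fin 4 → ℝ) (h0 : ℓ 0 = 0) (h1 : ℓ 1 = 0)
    (h2 : ℓ 2 ≤ 0) (h3 : ℓ 3 ≤ 0) : (-(∑ i, ℓ i • Matrix.vecMulVec (v i) (v i))).PosSemidef := by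
  refine posSemidef_neg_sum_smul_vecMulVec_of_nonpos v ℓ fun i => ?_
  fin_cases i
  · exact h0.le
  · exact h1.le
  · exact h2
  · exact h3

/-- **Double wall, opposite signs ⇒ indefinite.**  `ℓ₀ = ℓ₁ = 0`, `ℓ₂ > 0 > ℓ₃`, and `v₀, v₂, v₃` independent
(`det(v₂;v₀;v₃) ≠ 0`, equivalently any ordering) ⇒ `xᵀMx` takes both strict signs, so neither `M` nor `−M` is positive
semidefinite: the det-root on such a double wall is of INDEFINITE type. [folklore] -/
theorem indefinite_of_doubleWall_opposite (v : Fin 4 → Fin 3 → ℝ) (ℓ : Fin 4 → ℝ) (h0 : ℓ 0 = 0) (h1 : ℓ 1 = 0)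
    (h2 : 0 < ℓ 2) (h3 : ℓ 3 < 0)
    (hind : v 2 0 * (v 0 1 * v 3 2 - v 0 2 * v 3 1) - v 2 1 * (v 0 0 * v 3 2 - v 0 2 * v 3 0)
      + v 2 2 * (v 0 0 * v 3 1 - v 0 1 * v 3 0) ≠ 0) :
    ((∃ x : Fin 3 → ℝ, x ⬝ᵥ ((∑ i, ℓ i • Matrix.vecMulVec (v i) (v i)) *ᵥ x) < 0) ∧
      (∃ x : Fin 3 → ℝ, 0 < x ⬝ᵥ ((∑ i, ℓ i • Matrix.vecMulVec (v i) (v i)) *ᵥ x))) ∧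
    (¬ (∑ i, ℓ i • Matrix.vecMulVec (v i) (v i)).PosSemidef ∧ ¬ (-(∑ i, ℓ i • Matrix.vecMulVec (v i) (v i))).PosSemidef) := by
  -- test vectors: n = v₂ × v₀ (⊥ v₂, pairs with v₃ to ± det(v₂;v₀;v₃)) and z = v₃ × v₀ (⊥ v₃, pairs with v₂ to ∓ the same det)
  have hQ : ∀ x, x ⬝ᵥ ((∑ i, ℓ i • Matrix.vecMulVec (v i) (v i)) *ᵥ x)
      = ℓ 2 * (v 2 ⬝ᵥ x) ^ 2 + ℓ 3 * (v 3 ⬝ᵥ x) ^ 2 := fun x => by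
    rw [quadForm_sum_four_rankOne]; simp only [Fin.sum_univ_four, h0, h1]; ring
  refine not_posSemidef_of_testValues
    (![v 2 1 * v 0 2 - v 2 2 * v 0 1, v 2 2 * v 0 0 - v 2 0 * v 0 2, v 2 0 * v 0 1 - v 2 1 * v 0 0])
    (![v 3 1 * v 0 2 - v 3 2 * v 0 1, v 3 2 * v 0 0 - v 3 0 * v 0 2, v 3 0 * v 0 1 - v 3 1 * v 0 0])
    (Qn := ℓ 3 * (v 2 0 * (v 0 1 * v 3 2 - v 0 2 * v 3 1) - v 2 1 * (v 0 0 * v 3 2 - v 0 2 * v 3 0)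
      + v 2 2 * (v 0 0 * v 3 1 - v 0 1 * v 3 0)) ^ 2)
    (Qz := ℓ 2 * (v 3 0 * (v 0 1 * v 2 2 - v 0 2 * v 2 1) - v 3 1 * (v 0 0 * v 2 2 - v 0 2 * v 2 0)
      + v 3 2 * (v 0 0 * v 2 1 - v 0 1 * v 2 0)) ^ 2) ?_ ?_ ?_
  · rw [hQ, dotProduct_cross_left, dotProduct_cross_third]; ring
  · rw [hQ, dotProduct_cross_left, dotProduct_cross_third]; ring
  · have hsq : 0 < (v 2 0 * (v 0 1 * v 3 2 - v 0 2 * v 3 1) - v 2 1 * (v 0 0 * v 3 2 - v 0 2 * v 3 0)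
        + v 2 2 * (v 0 0 * v 3 1 - v 0 1 * v 3 0)) ^ 2 := by positivity
    have hsq' : (v 3 0 * (v 0 1 * v 2 2 - v 0 2 * v 2 1) - v 3 1 * (v 0 0 * v 2 2 - v 0 2 * v 2 0)
        + v 3 2 * (v 0 0 * v 2 1 - v 0 1 * v 2 0)) ^ 2
        = (v 2 0 * (v 0 1 * v 3 2 - v 0 2 * v 3 1) - v 2 1 * (v 0 0 * v 3 2 - v 0 2 * v 3 0)
          + v 2 2 * (v 0 0 * v 3 1 - v 0 1 * v 3 0)) ^ 2 := by ring
    rw [hsq']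
    nlinarith [mul_neg_of_neg_of_pos h3 hsq, mul_pos h2 hsq]

/-! ### Class R2: the double wall of the two real nodes -/

/-- **R2 double wall is a det-root**: `det (0·v₀v₀ᵀ + 0·v₁v₁ᵀ + m_R(rrᵀ−ssᵀ) − m_I(rsᵀ+srᵀ)) = 0`. [folklore] -/
theorem det_R2_doubleWall (v₀ v₁ r s : Fin 3 → ℝ) (mR mI : ℝ) :
    ((0 : ℝ) • Matrix.vecMulVec v₀ v₀ + (0 : ℝ) • Matrix.vecMulVec v₁ v₁
        + mR • (Matrix.vecMulVec r r - Matrix.vecMulVec s s) - mI • (Matrix.vecMulVec r s + Matrix.vecMulVec s r)).det = 0 := by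
  rw [det_R2_eq]; ring

/-- The quadratic form of the R2 matrix on the double wall, at a vector `x`: `m_R((r·x)² − (s·x)²) − 2m_I(r·x)(s·x)`. [folklore] -/
theorem quadForm_R2_doubleWall (v₀ v₁ r s : Fin 3 → ℝ) (mR mI : ℝ) (x : Fin 3 → ℝ) :
    x ⬝ᵥ (((0 : ℝ) • Matrix.vecMulVec v₀ v₀ + (0 : ℝ) • Matrix.vecMulVec v₁ v₁
        + mR • (Matrix.vecMulVec r r - Matrix.vecMulVec s s) - mI • (Matrix.vecMulVec r s + Matrix.vecMulVec s r)) *ᵥ x)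
      = mR * ((r ⬝ᵥ x) ^ 2 - (s ⬝ᵥ x) ^ 2) - 2 * mI * ((r ⬝ᵥ x) * (s ⬝ᵥ x)) := by
  rw [quadForm_R2]; ring

/-- **Test vectors for the pair `(r, s)`.**  With `n = r × s`, the vectors `x₁ = s × n` and `x₂ = r × n` satisfy
`r·x₁ = G`, `s·x₁ = 0`, `r·x₂ = 0`, `s·x₂ = −G` where `G = ‖r × s‖²`. [folklore] -/
theorem exists_pair_testVectors (r s : Fin 3 → ℝ) :
    ∃ x₁ x₂ : Fin 3 → ℝ,
      r ⬝ᵥ x₁ = (r 1 * s 2 - r 2 * s 1) ^ 2 + (r 2 * s 0 - r 0 * s 2) ^ 2 + (r 0 * s 1 - r 1 * s 0) ^ 2 ∧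
      s ⬝ᵥ x₁ = 0 ∧ r ⬝ᵥ x₂ = 0 ∧
      s ⬝ᵥ x₂ = -((r 1 * s 2 - r 2 * s 1) ^ 2 + (r 2 * s 0 - r 0 * s 2) ^ 2 + (r 0 * s 1 - r 1 * s 0) ^ 2) := by
  refine ⟨![s 1 * (r 0 * s 1 - r 1 * s 0) - s 2 * (r 2 * s 0 - r 0 * s 2),
            s 2 * (r 1 * s 2 - r 2 * s 1) - s 0 * (r 0 * s 1 - r 1 * s 0),
            s 0 * (r 2 * s 0 - r 0 * s 2) - s 1 * (r 1 * s 2 - r 2 * s 1)],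
          ![r 1 * (r 0 * s 1 - r 1 * s 0) - r 2 * (r 2 * s 0 - r 0 * s 2),
            r 2 * (r 1 * s 2 - r 2 * s 1) - r 0 * (r 0 * s 1 - r 1 * s 0),
            r 0 * (r 2 * s 0 - r 0 * s 2) - r 1 * (r 1 * s 2 - r 2 * s 1)], ?_, ?_, ?_, ?_⟩ <;>
  · simp only [dotProduct, Fin.sum_univ_three, Matrix.cons_val_zero, Matrix.cons_val_one, Matrix.cons_val]
    ring

/-- **INDEFINITE TYPE on an R2 double wall (abstract test vectors).**  If `x₁, x₂` have `r·x₁ = G`, `s·x₁ = 0`,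
`r·x₂ = 0`, `s·x₂ = −G` with `G ≠ 0`, and `(m_R, m_I) ≠ 0`, then the quadratic form of
`N = m_R(rrᵀ−ssᵀ) − m_I(rsᵀ+srᵀ)` takes both strict signs (test values `±m_R G²`, `±2 m_I G²`). [folklore] -/
theorem indefinite_R2_doubleWall_of_testVectors (v₀ v₁ r s : Fin 3 → ℝ) (mR mI G : ℝ) (hm : 0 < mR ^ 2 + mI ^ 2)
    (hG : G ≠ 0) (x₁ x₂ : Fin 3 → ℝ) (hr1 : r ⬝ᵥ x₁ = G) (hs1 : s ⬝ᵥ x₁ = 0) (hr2 : r ⬝ᵥ x₂ = 0)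
    (hs2 : s ⬝ᵥ x₂ = -G) :
    (∃ x : Fin 3 → ℝ, x ⬝ᵥ ((((0 : ℝ) • Matrix.vecMulVec v₀ v₀ + (0 : ℝ) • Matrix.vecMulVec v₁ v₁
        + mR • (Matrix.vecMulVec r r - Matrix.vecMulVec s s) - mI • (Matrix.vecMulVec r s + Matrix.vecMulVec s r))) *ᵥ x) < 0) ∧
    (∃ x : Fin 3 → ℝ, 0 < x ⬝ᵥ ((((0 : ℝ) • Matrix.vecMulVec v₀ v₀ + (0 : ℝ) • Matrix.vecMulVec v₁ v₁
        + mR • (Matrix.vecMulVec r r - Matrix.vecMulVec s s) - mI • (Matrix.vecMulVec r s + Matrix.vecMulVec s r))) *ᵥ x)) := by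
  have hG2 : 0 < G ^ 2 := by positivity
  have q1 : x₁ ⬝ᵥ ((((0 : ℝ) • Matrix.vecMulVec v₀ v₀ + (0 : ℝ) • Matrix.vecMulVec v₁ v₁
        + mR • (Matrix.vecMulVec r r - Matrix.vecMulVec s s) - mI • (Matrix.vecMulVec r s + Matrix.vecMulVec s r))) *ᵥ x₁)
        = mR * G ^ 2 := by
    rw [quadForm_R2_doubleWall, hr1, hs1]; ring
  have q2 : x₂ ⬝ᵥ ((((0 : ℝ) • Matrix.vecMulVec v₀ v₀ + (0 : ℝ) • Matrix.vecMulVec v₁ v₁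
        + mR • (Matrix.vecMulVec r r - Matrix.vecMulVec s s) - mI • (Matrix.vecMulVec r s + Matrix.vecMulVec s r))) *ᵥ x₂)
        = -(mR * G ^ 2) := by
    rw [quadForm_R2_doubleWall, hr2, hs2]; ring
  have q3 : (x₁ + x₂) ⬝ᵥ ((((0 : ℝ) • Matrix.vecMulVec v₀ v₀ + (0 : ℝ) • Matrix.vecMulVec v₁ v₁
        + mR • (Matrix.vecMulVec r r - Matrix.vecMulVec s s) - mI • (Matrix.vecMulVec r s + Matrix.vecMulVec s r))) *ᵥ (x₁ + x₂))
        = 2 * mI * G ^ 2 := by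
    rw [quadForm_R2_doubleWall, dotProduct_add, dotProduct_add, hr1, hs1, hr2, hs2]; ring
  have q4 : (x₁ - x₂) ⬝ᵥ ((((0 : ℝ) • Matrix.vecMulVec v₀ v₀ + (0 : ℝ) • Matrix.vecMulVec v₁ v₁
        + mR • (Matrix.vecMulVec r r - Matrix.vecMulVec s s) - mI • (Matrix.vecMulVec r s + Matrix.vecMulVec s r))) *ᵥ (x₁ - x₂))
        = -(2 * mI * G ^ 2) := by
    rw [quadForm_R2_doubleWall, dotProduct_sub, dotProduct_sub, hr1, hs1, hr2, hs2]; ring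
  rcases lt_trichotomy mR 0 with hR | hR | hR
  · exact ⟨⟨x₁, by rw [q1]; exact mul_neg_of_neg_of_pos hR hG2⟩,
      ⟨x₂, by rw [q2]; exact neg_pos.mpr (mul_neg_of_neg_of_pos hR hG2)⟩⟩
  · have hI : mI ≠ 0 := by
      intro h0; rw [hR, h0] at hm; norm_num at hm
    rcases lt_or_gt_of_ne hI with hI' | hI'
    · have h2 : 2 * mI < 0 := by linarith
      exact ⟨⟨x₁ + x₂, by rw [q3]; exact mul_neg_of_neg_of_pos h2 hG2⟩,
        ⟨x₁ - x₂, by rw [q4]; exact neg_pos.mpr (mul_neg_of_neg_of_pos h2 hG2)⟩⟩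
    · have h2 : 0 < 2 * mI := by linarith
      exact ⟨⟨x₁ - x₂, by rw [q4]; exact neg_neg_of_pos (mul_pos h2 hG2)⟩,
        ⟨x₁ + x₂, by rw [q3]; exact mul_pos h2 hG2⟩⟩
  · exact ⟨⟨x₂, by rw [q2]; exact neg_neg_of_pos (mul_pos hR hG2)⟩,
      ⟨x₁, by rw [q1]; exact mul_pos hR hG2⟩⟩

/-- **INDEFINITE TYPE on an R2 double wall.**  With `G := ‖r × s‖² ≠ 0` (i.e. `r, s` independent) and `(m_R, m_I) ≠ 0`, the
quadratic form `xᵀNx` of `N = m_R(rrᵀ−ssᵀ) − m_I(rsᵀ+srᵀ)` takes both strict signs. [folklore] -/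
theorem indefinite_R2_doubleWall (v₀ v₁ r s : Fin 3 → ℝ) (mR mI : ℝ) (hm : 0 < mR ^ 2 + mI ^ 2)
    (hG : (r 1 * s 2 - r 2 * s 1) ^ 2 + (r 2 * s 0 - r 0 * s 2) ^ 2 + (r 0 * s 1 - r 1 * s 0) ^ 2 ≠ 0) :
    (∃ x : Fin 3 → ℝ, x ⬝ᵥ ((((0 : ℝ) • Matrix.vecMulVec v₀ v₀ + (0 : ℝ) • Matrix.vecMulVec v₁ v₁
        + mR • (Matrix.vecMulVec r r - Matrix.vecMulVec s s) - mI • (Matrix.vecMulVec r s + Matrix.vecMulVec s r))) *ᵥ x) < 0) ∧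
    (∃ x : Fin 3 → ℝ, 0 < x ⬝ᵥ ((((0 : ℝ) • Matrix.vecMulVec v₀ v₀ + (0 : ℝ) • Matrix.vecMulVec v₁ v₁
        + mR • (Matrix.vecMulVec r r - Matrix.vecMulVec s s) - mI • (Matrix.vecMulVec r s + Matrix.vecMulVec s r))) *ᵥ x)) := by
  obtain ⟨x₁, x₂, hr1, hs1, hr2, hs2⟩ := exists_pair_testVectors r s
  exact indefinite_R2_doubleWall_of_testVectors v₀ v₁ r s mR mI _ hm hG x₁ x₂ hr1 hs1 hr2 hs2

/-- **Neither `N` nor `−N` is positive semidefinite on an R2 double wall** (the det-root there is of indefinite = middle-eigenvalue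
type). [folklore] -/
theorem not_posSemidef_R2_doubleWall (v₀ v₁ r s : Fin 3 → ℝ) (mR mI : ℝ) (hm : 0 < mR ^ 2 + mI ^ 2)
    (hG : (r 1 * s 2 - r 2 * s 1) ^ 2 + (r 2 * s 0 - r 0 * s 2) ^ 2 + (r 0 * s 1 - r 1 * s 0) ^ 2 ≠ 0) :
    ¬ ((0 : ℝ) • Matrix.vecMulVec v₀ v₀ + (0 : ℝ) • Matrix.vecMulVec v₁ v₁
        + mR • (Matrix.vecMulVec r r - Matrix.vecMulVec s s) - mI • (Matrix.vecMulVec r s + Matrix.vecMulVec s r)).PosSemidef ∧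
    ¬ (-((0 : ℝ) • Matrix.vecMulVec v₀ v₀ + (0 : ℝ) • Matrix.vecMulVec v₁ v₁
        + mR • (Matrix.vecMulVec r r - Matrix.vecMulVec s s) - mI • (Matrix.vecMulVec r s + Matrix.vecMulVec s r))).PosSemidef := by
  obtain ⟨⟨x, hx⟩, ⟨y, hy⟩⟩ := indefinite_R2_doubleWall v₀ v₁ r s mR mI hm hG
  constructor
  · intro hpsd
    have h := hpsd.dotProduct_mulVec_nonneg x
    rw [star_trivial] at h
    exact absurd hx (not_lt.mpr h)
  · intro hpsd
    have h := hpsd.dotProduct_mulVec_nonneg y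
    rw [star_trivial, Matrix.neg_mulVec, dotProduct_neg] at h
    exact absurd hy (not_lt.mpr (neg_nonneg.mp h))

end Summit.ValiantsHypothesis.ValiantsHypothesis.Theorems.LacunarySymmetroidMatrixDescartes.Census
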